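/-
Copyright: rh-split cell, typer-2 gen 9, 2026-08-28.  LADDER-RH bookkeeping.  A named published
theorem is CITED here, not proved; nothing in this file bears on the truth of RH.
-/
import Literature.NumberTheory.LFunctions.PolyaSignChanges
import Summits.RiemannHypothesis.RiemannHypothesis.Theses.ScrewPolyaSigns

/-!
# [24464] `ScrewPolyaSigns.PolyaLandauR` — discharged BY CITATION from Grosswald 1967, Theorem B

Item stmt-RiemannHypothesis-24464 (`Summit.RiemannHypothesis.RiemannHypothesis.Theses.ScrewPolyaSigns.PolyaLandauR`,
route `ScrewPolyaSigns`, the quantitative one-sided Pólya–Landau sign-change bound) is obtained from the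
NAMED FACT `Literature.NumberTheory.LFunctions.PolyaSignChanges.Grosswald1967_thmB`
([cite: Grosswald1967, §4 Theorem B, pp. 4–5]; Trans. Amer. Math. Soc. 126 — Pólya's theorem in the
limsup / upper-density form `limsup W(y)/log y ≥ γ/π`; the `γ = +∞` case leans on Steinig 1969
(acq-13640, NOT held); Pólya 1930 Satz III itself is acq-13600, open) through the landed corollary
`Grosswald1967_thmB.exists_holomorphic_extension_of_chain_bound` (contrapositive reading, PROVED in the
Literature file).  The theorem below is therefore a CONDITIONAL RESULT: `PolyaLandauR` modulo the named
fact `Grosswald1967_thmB` (hypothesis `h`); it discharges nothing unconditionally and funds no printed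
theorem (D-0145: the printed theorem is cited, not formalised).

Term of record = rh-split-ref g12 probe `PLR_of_thmB_probe.lean` cdafdb84d6212f4f (farm rc 0, axioms
`[propext, Classical.choice, Quot.sound]`) = idea-crit-2 `L54_Discharge24464_by_Grosswald1967_thmB.lean`
2b655cc22223c1e9; keyed by director-rh g13 (BX2) / rh-split-lead RULING #481.

HONEST LABEL: SPLITTING SEARCH over kernel-typed RH-EQUIVALENCES; a splitting `A ∧ B ⟹ RH` is CONDITIONAL
bookkeeping unless `A` and `B` are both proved; nothing here bears on the truth of RH.
-/

-- D-0017: `Summit.RiemannHypothesis.RiemannHypothesis.…` duplicates the namespace BY DESIGN (single-problem summit).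
set_option linter.dupNamespace false

namespace Summit.RiemannHypothesis.RiemannHypothesis.Theorems

open Literature.NumberTheory.LFunctions.PolyaSignChanges in
/-- **[24464] by citation.**  Under the named fact `Grosswald1967_thmB` (Grosswald 1967, TAMS 126, §4
Theorem B; `γ = ∞` case: Steinig 1969), the route statement `ScrewPolyaSigns.PolyaLandauR` holds: a real
`g` on `(1, ∞)` whose alternating sign chains in `(1, X]` have length `≤ D log X + B`, and whose Mellin
transform continues meromorphically past `θ` and holomorphically on `{θ < re} ∪ {θ − η < re, |im| < πD + η}`,
has a holomorphic continuation to some half-plane `{θ − ε < re}`, `ε > 0`.  CONDITIONAL on `h`; the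
`ContinuousOn` hypothesis of `PolyaLandauR` is not needed and is dropped (`_`).
[cite: Grosswald1967, §4 Theorem B, pp. 4–5] -/
theorem polyaLandauR_of_grosswald1967 (h : Grosswald1967_thmB) :
    Summit.RiemannHypothesis.RiemannHypothesis.Theses.ScrewPolyaSigns.PolyaLandauR :=
  fun g σ₁ θ b η D B _ hint hchain hθ hb hη Φ hmer hhol heq =>
    h.exists_holomorphic_extension_of_chain_bound g σ₁ θ b η D B hint hchain hθ hb hη Φ hmer hhol heq

end Summit.RiemannHypothesis.RiemannHypothesis.Theorems
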